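import Summits.HodgeConjecture.HodgeConjecture.Theses.EndoscopicMiddleDegree

/-!
# Route EndoscopicMiddleDegree · `FourfoldHodge` (stmt-HodgeConjecture-13663) — calibration

The route item `FourfoldHodge` (support, rank 9): granted the route's target `MiddleDegreeStep`
(the Hodge conjecture propagates from degree `2` to the middle degree `4` on fourfolds carrying a
`UnitaryBallQuotientDatum 4 X`) and, as BINDERS, the classical facts on smooth projective
fourfolds — Lefschetz `(1,1)` (codimension `1`), the hard-Lefschetz reduction (for `4 < 2p`, the
Hodge conjecture in codimension `4 - p` gives it in codimension `p`; Voisin I Thm 6.25, Rem 6.27,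
§7.1.2) and the existence of a Hodge model — the Hodge conjecture `HodgeConjectureFor 4 X` holds
for every `X` carrying a `UnitaryBallQuotientDatum 4 X` (compact arithmetic ball-quotient
fourfolds of simple unitary type).

PROOF (pure bookkeeping, a case split on the codimension `p`): `X` is smooth projective of
dimension `4` by the datum's field `isSmoothProjective`; the Hodge-model conjunct is the binder;
codimension `0` is the tree's `hodgeConjectureFor_codim_zero`, codimension `1` is the Lefschetz
binder, codimension `2` is `MiddleDegreeStep` at `m = 1` fed by the Lefschetz binder, and every
codimension `p ≥ 3` is the reduction binder fed by codimension `4 - p ∈ {0, 1}`.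
Unconditional (no named facts are hypotheses of the theorem beyond the item's own binders).
-/

noncomputable section

open Literature.AlgebraicGeometry.Motives Literature.AlgebraicGeometry.HodgeTheory
open Literature.AlgebraicGeometry.ShimuraVarieties

namespace Summit.HodgeConjecture.HodgeConjecture.Theorems

/-- **The Hodge conjecture for compact arithmetic ball-quotient fourfolds, granted the middle
degree and the classical binders** — the route decl `FourfoldHodge` of `EndoscopicMiddleDegree`:
`MiddleDegreeStep`, Lefschetz `(1,1)` on smooth projective fourfolds, the hard-Lefschetz
reduction on fourfolds (`4 < 2p`: codimension `4 - p` ⟹ codimension `p`) and Hodge-model existence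
give `HodgeConjectureFor 4 X` for every `X` with a `UnitaryBallQuotientDatum 4 X`. Case split on
the codimension: `0` (tree, `hodgeConjectureFor_codim_zero`), `1` (Lefschetz), `2`
(`MiddleDegreeStep` at `m = 1`), `≥ 3` (reduction from codimension `4 - p ≤ 1`).
[cite: VoisinHodgeI2002, Thm 6.25, Rem 6.27, §7.1.2 and §11.3] -/
theorem fourfoldHodge_proof : Theses.EndoscopicMiddleDegree.FourfoldHodge := by
  unfold Theses.EndoscopicMiddleDegree.FourfoldHodge
  intro hStep hLef hRed hModel X hD
  obtain ⟨D⟩ := hD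
  have hX : IsSmoothProjective 4 X := D.isSmoothProjective
  refine ⟨hModel X hX, fun p c hc hpp ↦ ?_⟩
  -- the Hodge conjecture for `X` in codimension `q ≤ 1`: the tree (`q = 0`) and Lefschetz (`q = 1`)
  have low : ∀ q, q ≤ 1 → ∀ a : complexBetti X (2 * q), IsRationalClass a →
      IsOfHodgeType 4 X (2 * q) q q a → a ∈ algebraicClasses X q := by
    intro q hq a ha haa
    rcases q with _ | _ | q
    · exact hodgeConjectureFor_codim_zero a
    · exact hLef X hX a ha haa
    · omega
  rcases Nat.lt_or_ge 2 p with hp | hp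
  · -- codimension `p ≥ 3`: the hard-Lefschetz reduction from codimension `4 - p ≤ 1`
    exact hRed X hX p (by omega) (low (4 - p) (by omega)) c hc hpp
  · rcases Nat.lt_or_ge 1 p with hp1 | hp1
    · -- codimension `2`, the middle degree: `MiddleDegreeStep` at `m = 1`, fed by Lefschetz
      obtain rfl : p = 2 := le_antisymm hp hp1
      exact hStep 1 X le_rfl one_le_two ⟨D⟩ (hLef X hX) c hc hpp
    · -- codimension `≤ 1`
      exact low p hp1 c hc hpp

end Summit.HodgeConjecture.HodgeConjecture.Theorems

end
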